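import Mathlib
import Summits.ValiantsHypothesis.ValiantsHypothesis.Theorems.NewtonUnitEquationsTwoProductsMomentRecordDefs

/-!
# val-idea-34 g6 — Lemma V (valuation heredity) is NEWTON, not invariant theory

crit-8 g2 VERDICT #16 (2026-08-28T22:04:34Z) sized g5's Lemma V
  `ord_z (M_u S' − M_v S') ≥ min { ord_z (M_u T − M_v T) : T ≤ S', |T| ≤ m }`
as «L-sized in Lean: multisymmetric generation is not in Mathlib».

This file shows it is M/S-sized: the only algebra needed is the ONE-alphabet Newton identities,
which Mathlib has (`MvPolynomial.mul_esymm_eq_sum`, `MvPolynomial.psum_eq_mul_esymm_sub_sum`),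
applied inside the commutative ℚ-algebra `B = (R ⧸ I)[x_1..x_n] ⧸ (x^D : ¬ D ≤ S')` to the `m`
linear forms `L_j = Σ_i u_{ji} x_i`.

* `psum_eq_of_psum_eq_le` (PROVED, sorry-free): in any commutative ℚ-algebra, if two `m`-tuples have
  equal power sums of orders `1..m`, they have equal power sums of every order.
* `VectorPowerSumHeredity` (the statement of Lemma V over an arbitrary ideal `I`; reduction in the
  docstring, 5 bookkeeping steps over named Mathlib lemmas).

VP ≠ VNP is NOT proved; stmt-ValiantsHypothesis-5906 is OPEN. Evidence/sketch file only.
-/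

open MvPolynomial Finset

namespace ValIdea34g6

section NewtonDetermination

variable {B : Type*} [CommRing B] [Algebra ℚ B] {m : ℕ}

lemma aeval_psum_fin (f : Fin m → B) (n : ℕ) :
    aeval f (psum (Fin m) ℚ n) = ∑ j, f j ^ n := by
  simp [psum, map_sum, map_pow, aeval_X]

lemma esymm_fin_eq_zero_of_lt {k : ℕ} (hk : m < k) : esymm (Fin m) ℚ k = 0 := by
  rw [MvPolynomial.esymm, Finset.powersetCard_eq_empty.mpr (by simpa using hk), Finset.sum_empty]

/-- nonzero naturals are units in a `ℚ`-algebra: cancellation. -/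
lemma natCast_mul_cancel {k : ℕ} (hk : k ≠ 0) {x y : B} (h : (k : B) * x = (k : B) * y) :
    x = y := by
  have hq : (k : ℚ) ≠ 0 := by exact_mod_cast hk
  have hunit : (algebraMap ℚ B (k : ℚ)⁻¹) * (k : B) = 1 := by
    rw [← map_natCast (algebraMap ℚ B) k, ← map_mul, inv_mul_cancel₀ hq, map_one]
  calc x = (algebraMap ℚ B (k : ℚ)⁻¹) * (k : B) * x := by rw [hunit, one_mul]
    _ = (algebraMap ℚ B (k : ℚ)⁻¹) * ((k : B) * x) := by rw [mul_assoc]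
    _ = (algebraMap ℚ B (k : ℚ)⁻¹) * ((k : B) * y) := by rw [h]
    _ = y := by rw [← mul_assoc, hunit, one_mul]

/-- Newton, direction p ⇒ e: equal power sums of orders `1..m` ⇒ equal elementary symmetric values. -/
theorem aeval_esymm_eq_of_psum_eq (a b : Fin m → B)
    (h : ∀ i, 1 ≤ i → i ≤ m → ∑ j, a j ^ i = ∑ j, b j ^ i) (k : ℕ) :
    aeval a (esymm (Fin m) ℚ k) = aeval b (esymm (Fin m) ℚ k) := by
  induction k using Nat.strong_induction_on with
  | h k ih =>
    rcases Nat.eq_zero_or_pos k with rfl | hkpos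
    · simp
    by_cases hkm : k ≤ m
    · have key := mul_esymm_eq_sum (Fin m) ℚ k
      have ha := congrArg (aeval a) key
      have hb := congrArg (aeval b) key
      simp only [map_mul, map_natCast, map_pow, map_neg, map_one, map_sum] at ha hb
      apply natCast_mul_cancel (Nat.pos_iff_ne_zero.mp hkpos)
      rw [ha, hb]
      congr 1
      refine Finset.sum_congr rfl (fun x hx => ?_)
      simp only [Finset.mem_filter, Finset.HasAntidiagonal.mem_antidiagonal] at hx
      obtain ⟨hx1, hx2⟩ := hx
      rw [ih x.1 hx2, aeval_psum_fin, aeval_psum_fin, h x.2 (by omega) (by omega)]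
    · simp [esymm_fin_eq_zero_of_lt (not_le.mp hkm)]

/-- **(V1)** Newton, both directions: in a commutative `ℚ`-algebra, the power sums of orders `1..m` of an
`m`-tuple determine the power sums of every order. -/
theorem psum_eq_of_psum_eq_le (a b : Fin m → B)
    (h : ∀ i, 1 ≤ i → i ≤ m → ∑ j, a j ^ i = ∑ j, b j ^ i) (K : ℕ) :
    ∑ j, a j ^ K = ∑ j, b j ^ K := by
  induction K using Nat.strong_induction_on with
  | h K ih =>
    rcases Nat.eq_zero_or_pos K with rfl | hKpos
    · simp
    have key := psum_eq_mul_esymm_sub_sum (Fin m) ℚ K hKpos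
    have ha := congrArg (aeval a) key
    have hb := congrArg (aeval b) key
    rw [aeval_psum_fin] at ha hb
    simp only [map_mul, map_sub, map_natCast, map_pow, map_neg, map_one, map_sum] at ha hb
    rw [ha, hb, aeval_esymm_eq_of_psum_eq a b h K]
    congr 1
    refine Finset.sum_congr rfl (fun x hx => ?_)
    simp only [Finset.mem_filter, Finset.HasAntidiagonal.mem_antidiagonal, Set.mem_Ioo] at hx
    obtain ⟨hx1, hx2, hx3⟩ := hx
    rw [aeval_esymm_eq_of_psum_eq a b h x.1, aeval_psum_fin, aeval_psum_fin, ih x.2 (by omega)]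

end NewtonDetermination

section VectorPowerSums

variable {R : Type*} [CommRing R]

/-- vector power sum (moment) `M_u(S) = Σ_j Π_i (u j i) ^ (S i)` of an `m`-tuple of letter vectors
`u j ∈ R^n` at the multi-index `S`. -/
def vecMoment {m n : ℕ} (u : Fin m → Fin n → R) (S : Fin n →₀ ℕ) : R :=
  ∑ j, ∏ i, u j i ^ S i

lemma prod_X_pow_eq_monomial' {n : ℕ} (κ : Fin n → ℕ) :
    (∏ i, (X i : MvPolynomial (Fin n) R) ^ κ i) = monomial (Finsupp.equivFunOnFinite.symm κ) 1 := by
  rw [monomial_eq, C_1, one_mul, Finsupp.prod_fintype _ _ (fun i => pow_zero _)]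
  simp

/-- multinomial expansion of the `k`-th power of a linear form. -/
lemma linearForm_pow_eq {n : ℕ} (c : Fin n → R) (k : ℕ) :
    (∑ i, C (c i) * X i : MvPolynomial (Fin n) R) ^ k =
      ∑ κ ∈ Finset.piAntidiag Finset.univ k,
        C ((Nat.multinomial Finset.univ κ : R) * ∏ i, c i ^ κ i) *
          monomial (Finsupp.equivFunOnFinite.symm κ) 1 := by
  rw [Finset.sum_pow_eq_sum_piAntidiag]
  refine Finset.sum_congr rfl (fun κ _ => ?_)
  rw [← prod_X_pow_eq_monomial', map_mul, map_natCast, map_prod, mul_assoc, ← Finset.prod_mul_distrib]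
  congr 1
  refine Finset.prod_congr rfl (fun i _ => ?_)
  rw [mul_pow, map_pow]

/-- coefficient of `x^D` in the `k`-th power of a linear form. -/
lemma coeff_linearForm_pow {n : ℕ} (c : Fin n → R) (k : ℕ) (D : Fin n →₀ ℕ) :
    coeff D ((∑ i, C (c i) * X i : MvPolynomial (Fin n) R) ^ k) =
      if (∑ i, D i) = k then (Nat.multinomial Finset.univ D : R) * ∏ i, c i ^ D i else 0 := by
  classical
  rw [linearForm_pow_eq, coeff_sum]
  simp_rw [coeff_C_mul, coeff_monomial]
  have key : ∀ κ : Fin n → ℕ, (Finsupp.equivFunOnFinite.symm κ = D ↔ κ = ⇑D) := by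
    intro κ
    constructor
    · rintro rfl; simp
    · rintro rfl; simp
  simp_rw [key]
  split_ifs with hD
  · rw [Finset.sum_eq_single (⇑D)]
    · simp
    · intro κ _ hne
      rw [if_neg hne, mul_zero]
    · intro hnot
      exfalso; apply hnot
      simp [Finset.mem_piAntidiag, hD]
  · apply Finset.sum_eq_zero
    intro κ hκ
    rw [if_neg, mul_zero]
    rintro rfl
    apply hD
    simpa [Finset.mem_piAntidiag] using hκ

/-- coefficient of `x^D` in the `k`-th power sum of the `m` linear forms `L_j = Σ_i (w j i) x_i`. -/
lemma coeff_psumLinear {m n : ℕ} (w : Fin m → Fin n → R) (k : ℕ) (D : Fin n →₀ ℕ) :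
    coeff D (∑ j, (∑ i, C (w j i) * X i : MvPolynomial (Fin n) R) ^ k) =
      if (∑ i, D i) = k then (Nat.multinomial Finset.univ D : R) * vecMoment w D else 0 := by
  rw [coeff_sum]
  simp_rw [coeff_linearForm_pow]
  split_ifs with h
  · simp [vecMoment, Finset.mul_sum]
  · simp

/-- the BOX IDEAL: polynomials all of whose coefficients at exponents `D ≤ S` lie in `I`
(= `I·R[x] + (x^D : ¬ D ≤ S)`). -/
def boxIdeal {n : ℕ} (I : Ideal R) (S : Fin n →₀ ℕ) : Ideal (MvPolynomial (Fin n) R) where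
  carrier := {f | ∀ D ≤ S, coeff D f ∈ I}
  zero_mem' := by intro D _; simp
  add_mem' := by
    intro f g hf hg D hD
    rw [coeff_add]; exact I.add_mem (hf D hD) (hg D hD)
  smul_mem' := by
    intro g f hf D hD
    rw [smul_eq_mul, coeff_mul]
    refine I.sum_mem (fun x hx => ?_)
    have hx2 : x.2 ≤ D := by
      rw [Finset.HasAntidiagonal.mem_antidiagonal] at hx
      rw [← hx]; exact le_add_self
    exact I.mul_mem_left _ (hf x.2 (hx2.trans hD))

lemma mem_boxIdeal {n : ℕ} {I : Ideal R} {S : Fin n →₀ ℕ} {f : MvPolynomial (Fin n) R} :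
    f ∈ boxIdeal I S ↔ ∀ D ≤ S, coeff D f ∈ I := Iff.rfl

/-- **Lemma V (valuation heredity), ideal form.**  For an ideal `I` of a commutative `ℚ`-algebra `R`
and two `m`-tuples of letter vectors: if `M_u(T) ≡ M_v(T) (mod I)` for every `T ≤ S` with
`1 ≤ |T| ≤ m`, then `M_u(S) ≡ M_v(S) (mod I)`.  (g5's form: `R = ℂ[z]`, `I = (z^k)`,
`k = min ord_z` over the shallow sub-multi-indices.) -/
def VectorPowerSumHeredity : Prop :=
  ∀ (R : Type) [CommRing R] [Algebra ℚ R] (I : Ideal R) (m n : ℕ)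
    (u v : Fin m → Fin n → R) (S : Fin n →₀ ℕ),
    (∀ T : Fin n →₀ ℕ, T ≤ S → 1 ≤ ∑ i, T i → ∑ i, T i ≤ m →
        vecMoment u T - vecMoment v T ∈ I) →
    vecMoment u S - vecMoment v S ∈ I

/-- **Lemma V holds** — by Newton's identities (`psum_eq_of_psum_eq_le`) in the box algebra
`R[x_1..x_n] ⧸ boxIdeal I S`, applied to the linear forms `L_j = Σ_i u_{ji} x_i`. -/
theorem vectorPowerSumHeredity : VectorPowerSumHeredity := by
  intro R _ _ I m n u v S hyp
  classical
  let Lu : Fin m → MvPolynomial (Fin n) R := fun j => ∑ i, C (u j i) * X i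
  let Lv : Fin m → MvPolynomial (Fin n) R := fun j => ∑ i, C (v j i) * X i
  -- (3) the shallow power sums agree modulo the box ideal
  have h3 : ∀ k, 1 ≤ k → k ≤ m → (∑ j, Lu j ^ k) - (∑ j, Lv j ^ k) ∈ boxIdeal I S := by
    intro k hk1 hkm
    rw [mem_boxIdeal]
    intro D hD
    rw [coeff_sub, coeff_psumLinear, coeff_psumLinear]
    split_ifs with hDk
    · rw [← mul_sub]
      exact I.mul_mem_left _ (hyp D hD (hDk ▸ hk1) (hDk ▸ hkm))
    · simp
  -- (4) Newton in the quotient: all power sums agree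
  have h4 := psum_eq_of_psum_eq_le
    (B := MvPolynomial (Fin n) R ⧸ boxIdeal I S)
    (fun j => Ideal.Quotient.mk (boxIdeal I S) (Lu j))
    (fun j => Ideal.Quotient.mk (boxIdeal I S) (Lv j)) (by
      intro i hi1 him
      have := (Ideal.Quotient.eq (I := boxIdeal I S)).mpr (h3 i hi1 him)
      simpa [map_sum, map_pow] using this)
  have h5 : (∑ j, Lu j ^ (∑ i, S i)) - (∑ j, Lv j ^ (∑ i, S i)) ∈ boxIdeal I S := by
    rw [← Ideal.Quotient.eq]
    simpa [map_sum, map_pow] using h4 (∑ i, S i)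
  -- (5) read the coefficient at `S` and cancel the multinomial
  have h6 := (mem_boxIdeal.mp h5) S le_rfl
  rw [coeff_sub, coeff_psumLinear, coeff_psumLinear, if_pos rfl, if_pos rfl, ← mul_sub] at h6
  have hne : (Nat.multinomial Finset.univ (⇑S) : ℚ) ≠ 0 := by
    exact_mod_cast (Nat.multinomial_pos _ _).ne'
  have : vecMoment u S - vecMoment v S =
      (algebraMap ℚ R (Nat.multinomial Finset.univ (⇑S) : ℚ)⁻¹) *
        ((Nat.multinomial Finset.univ (⇑S) : R) * (vecMoment u S - vecMoment v S)) := by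
    rw [← mul_assoc, ← map_natCast (algebraMap ℚ R), ← map_mul, inv_mul_cancel₀ hne, map_one,
      one_mul]
  rw [this]
  exact I.mul_mem_left _ h6

end VectorPowerSums

section LayerHeredity
/-! ### Corollary over the LANDED Defs (✓ p670581): layer heredity for `momentPoly` / `layer`
If all layers `k' < k` of the signed moment vanish at every shallow `T ≤ S` (`1 ≤ |T| ≤ m`), they vanish at `S`.
(= g5's Lemma V with `ord_z ≥ k`; the downstairs (A) ⇒ (B) glue input of VERDICT #16.) -/

open Polynomial
open Summit.ValiantsHypothesis.ValiantsHypothesis.Theorems.NewtonUnitEquations.TwoProducts.MomentRecord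

lemma momentPoly_eq_vecMoment {m n : ℕ} (α β : Fin m → Fin n → ℂ) (T : Fin n →₀ ℕ) :
    momentPoly α β ⇑T = vecMoment (fun j i => Polynomial.C (α j i) + Polynomial.X * Polynomial.C (β j i)) T := by
  simp [momentPoly, vecMoment]

lemma mem_span_X_pow_iff {p : ℂ[X]} {k : ℕ} :
    p ∈ Ideal.span ({(Polynomial.X : ℂ[X]) ^ k} : Set ℂ[X]) ↔ ∀ k' < k, p.coeff k' = 0 := by
  rw [Ideal.mem_span_singleton, Polynomial.X_pow_dvd_iff]

/-- **Layer heredity** (Lemma V over the landed `MomentRecordDefs`). -/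
theorem layer_heredity {m n : ℕ} (α β α' β' : Fin m → Fin n → ℂ) (S : Fin n → ℕ) (k : ℕ)
    (h : ∀ T : Fin n → ℕ, T ≤ S → 1 ≤ size T → size T ≤ m → ∀ k' < k, layer α β α' β' k' T = 0) :
    ∀ k' < k, layer α β α' β' k' S = 0 := by
  have main := vectorPowerSumHeredity ℂ[X] (Ideal.span {(Polynomial.X : ℂ[X]) ^ k}) m n
    (fun j i => Polynomial.C (α j i) + Polynomial.X * Polynomial.C (β j i))
    (fun j i => Polynomial.C (α' j i) + Polynomial.X * Polynomial.C (β' j i))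
    (Finsupp.equivFunOnFinite.symm S) (by
      intro T hT h1 hm
      rw [← momentPoly_eq_vecMoment, ← momentPoly_eq_vecMoment, mem_span_X_pow_iff]
      have hT' : (⇑T : Fin n → ℕ) ≤ S := by
        intro i
        have := hT i
        simpa using this
      exact h (⇑T) hT' h1 hm)
  rw [mem_span_X_pow_iff] at main
  intro k' hk'
  have key := main k' hk'
  rw [← momentPoly_eq_vecMoment, ← momentPoly_eq_vecMoment] at key
  simpa [layer] using key

end LayerHeredity

end ValIdea34g6
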